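import Mathlib.NumberTheory.Real.Irrational
import Literature.AlgebraicGeometry.HodgeTheory.KaehlerClass

/-!
# `NikulinSerreCarrier` (stmt-HodgeConjecture-14464) · Negative · the sign normalisation of line
`neron-severi-intertwiner` is degenerate

Negative knowledge (refuter drefute, 2026-08-16) for the typed algebraic normal form
`NikulinSerreCarrierAlg` of the informal crux `NikulinSerreCarrier` (crux work-files
`Cruxes/NikulinSerreCarrier/TypedCruxAlg.lean`, `Cruxes/NikulinSerreCarrier/Lines/neron-severi-intertwiner.lean`;
evidence SIGNATURE-PROPOSAL.md proposes it as the item's signature) and for its hardest stub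
`stub_stableCarrierNSBlock` (S3).  Both carry the hypothesis `SignNormalised C` on the Chern character
instance `C : ChernCharacterBetti`, here spelled out VERBATIM (def-free) as the section hypothesis `hC`:

  `∀ W Ω vol, IsSmoothProjective 4 W → IsKaehlerClass 4 W Ω → (∃ q : ℚ, 0 < q ∧ Ω⁴ = q • vol) →`
  `  ∀ L, HasRankLE L 1 → (∃ s : 𝒪_W ⟶ L, Mono s) → ∃ d : ℚ, 0 ≤ d ∧ ch₁(L) ∪ Ω³ = d • vol`

(`SignNormalised`, `PositivelyOriented`, `EffectiveNonneg`, `HasDegree` of the skeleton unfolded; the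
skeleton's local `IsKaehlerClass` has the same body as the Literature predicate used here, file
`HodgeTheory/KaehlerClass`).  The degree `d` is asked to be RATIONAL, but `Ω` ranges over ALL Kähler
classes — classes of Kähler forms, real and in general IRRATIONAL — and positive real multiples of Kähler
classes are Kähler (`IsKaehlerClass.smul_of_pos`).  Testing `hC` at `(Ω, Ω⁴)` and at
`(√2 • Ω, (√2 • Ω)⁴)` (both positively oriented with `q = 1`) yields rational `d₁, d₂` with
`ch₁(L) ∪ Ω³ = d₁ • Ω⁴` and `(√2)³ · ch₁(L) ∪ Ω³ = d₂ (√2)⁴ • Ω⁴`; as `Ω⁴ ≠ 0`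
(`IsKaehlerClass.cupPowTwo_ne_zero`, Voisin I Cor. 3.9), `d₁ = √2 · d₂`, so `d₁ = d₂ = 0`:

* `cupProduct_ch_one_cupPowTwo_eq_zero_of_signNormalised` — **the hypothesis forces EVERY effective line
  bundle on EVERY smooth projective fourfold to have ZERO degree against EVERY Kähler class;**
* `not_isKaehlerClass_ch_one_of_signNormalised` — hence no effective line bundle on a smooth projective
  fourfold has a Kähler first Chern character (take `Ω = ch₁(L)`: `ch₁(L)⁴ = 0` contradicts Cor. 3.9);
* `not_signNormalised_of_isKaehlerClass_ch_one`, `not_signNormalised_of_degree_ne_zero` — the usable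
  contrapositives: ONE effective line bundle with Kähler `ch₁` (for the Chern character: `𝒪_{ℙ⁴}(1)`,
  `c₁ = [ω_FS]`, Voisin I Thm. 7.10 / Lemma 3.16), or of non-zero degree against one Kähler class, on
  ONE smooth projective fourfold refutes the hypothesis for `C`.  So `SignNormalised` excludes the Chern
  character and all its positive rescalings — exactly the instances its docstring says it KEEPS ("FALSE
  for the sign-flipped instance … makes `μ_Ω`-stable mean stable rather than anti-stable").
* `forall_of_not_signNormalised` — the shape of the consequence: every statement
  `∀ C, Q C → SignNormalised C → P C` (the typed crux `NikulinSerreCarrierAlg`, the stub S3) holds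
  outright once the hypothesis is unsatisfiable.

VERDICT `stub-misstated` (S3 and the proposed signature): the antecedent is unsatisfiable by the intended
instances, so S3 and `NikulinSerreCarrierAlg` are VACUOUSLY TRUE at the mathematical level and the line,
as typed, proves nothing about carriers; installed verbatim as the signature of stmt-HodgeConjecture-14464
it would make the crux item trivially closable.  REPAIR (minimal, either of): (a) restrict to RATIONAL
Kähler classes — insert `IsRationalClass Ω →` before `IsKaehlerClass 4 W Ω` (then `vol = q⁻¹ • Ω⁴` is
rational, `H⁸(W(ℂ); ℂ)` is a line — `finrank_complexBetti_two_mul_eq_one` — so degrees of the rational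
classes `ch₁(L) ∪ Ω³` exist in `ℚ`, are `≥ 0` for `ch` and `< 0` somewhere for `−ch`); (b) weaken the
conclusion to the pure sign condition `∀ d : ℚ, ch₁(L) ∪ Ω³ = d • vol → 0 ≤ d`.  The `√2`-scaling
witness bites neither repair (a rational rescaling `Ω ↦ t • Ω`, `t ∈ ℚ_{>0}`, rescales a rational degree
by `t⁻¹`).  The same rational-versus-real slip does NOT affect `IsMuStable` at the anchor: there
`Ω = Ψ H′ ⊞ H′` is rational (`IsRationalClass H'`, `Ψ` rational).

Refuter seat refuter-drefute-stmt-HodgeConjecture-14464-0 (drefute, line neron-severi-intertwiner), 2026-08-16.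
-/

noncomputable section

open CategoryTheory CategoryTheory.Limits AlgebraicGeometry
open Literature.AlgebraicGeometry
open Literature.AlgebraicGeometry.HodgeTheory
open Literature.AlgebraicTopology.SingularHomology

namespace Summit.HodgeConjecture.HodgeConjecture.Theorems.NikulinSerreCarrier.Negative.SignNormalisedDegenerate

/-! ## Cup-power bookkeeping -/

/-- Degree bookkeeping: `2·1 + 2·3 = 2·4` (the skeleton's `deg_1_3`). [folklore] -/
theorem deg_1_3 : 2 * 1 + 2 * 3 = 2 * 4 := by norm_num

/-- `(c • x)ⁱ = cⁱ • xⁱ` for the cup powers of a degree-`2` class (bilinearity of `⌣`). [folklore] -/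
theorem cupPowTwo_smul {Y : Type} [TopologicalSpace Y] (c : ℂ) (x : singularCohomology ℂ ℂ Y 2) :
    ∀ i : ℕ, cupPowTwo (c • x) i = c ^ i • cupPowTwo x i
  | 0 => by rw [cupPowTwo_zero, cupPowTwo_zero, pow_zero, one_smul]
  | i + 1 => by
    rw [cupPowTwo_succ, cupPowTwo_succ, cupPowTwo_smul c x i, map_smul, map_smul,
      LinearMap.smul_apply, smul_smul, ← pow_succ']

/-- `x^{i+j} = xⁱ ∪ xʲ` for the cup powers of a degree-`2` class (associativity of `⌣`). [folklore] -/
theorem cupPowTwo_add {Y : Type} [TopologicalSpace Y] (x : singularCohomology ℂ ℂ Y 2) (i : ℕ) :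
    ∀ j : ℕ, cupPowTwo x (i + j) = cupProduct (two_mul_add_two_mul i j) (cupPowTwo x i) (cupPowTwo x j)
  | 0 => (cupProduct_one _).symm
  | j + 1 => by
    rw [cupPowTwo_succ x j]
    change cupProduct (two_mul_add_two (i + j)) (cupPowTwo x (i + j)) x = _
    rw [cupPowTwo_add x i j,
      cupProduct_assoc (two_mul_add_two_mul i j) (two_mul_add_two j) (two_mul_add_two (i + j))
        (two_mul_add_two_mul i (j + 1))]

/-! ## The degeneracy theorem -/

section SignNormalised

variable (C : ChernCharacterBetti)
  /- `SignNormalised C` of the skeleton, unfolded verbatim (`PositivelyOriented`, `EffectiveNonneg`,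
  `HasDegree` inlined). -/
  (hC : ∀ (W : Motives.SchemeOver ℂ) (Ω : complexBetti W (2 * 1)) (vol : complexBetti W (2 * 4)),
    Motives.IsSmoothProjective 4 W → IsKaehlerClass 4 W Ω →
      (∃ q : ℚ, 0 < q ∧ cupPowTwo Ω 4 = (q : ℂ) • vol) →
        ∀ (L : W.left.Modules), Motives.HasRankLE L 1 →
          (∃ s : SheafOfModules.free (R := W.left.ringCatSheaf) PUnit ⟶ L, Mono s) →
            ∃ d : ℚ, 0 ≤ d ∧ cupProduct deg_1_3 (C.ch W L 1) (cupPowTwo Ω 3) = (d : ℂ) • vol)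

include hC

/-- **`SignNormalised C` forces zero Kähler degrees.**  For every smooth projective fourfold `W`,
every Kähler class `Ω` and every effective line bundle `L` (rank `≤ 1`, a mono `𝒪_W ↪ L`):
`ch₁(L) ∪ Ω³ = 0`.  Proof: test the normalisation at `(Ω, Ω⁴)` and at `(√2 • Ω, (√2 • Ω)⁴)`; the two
rational degrees satisfy `d₁ = √2 · d₂` because `Ω⁴ ≠ 0`, so both vanish.
[cite: VoisinHodgeI2002, §3.1.3 Cor. 3.9] -/
theorem cupProduct_ch_one_cupPowTwo_eq_zero_of_signNormalised {W : Motives.SchemeOver ℂ}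
    (hW : Motives.IsSmoothProjective 4 W) {Ω : complexBetti W (2 * 1)} (hΩ : IsKaehlerClass 4 W Ω)
    (L : W.left.Modules) (hL : Motives.HasRankLE L 1)
    (hs : ∃ s : SheafOfModules.free (R := W.left.ringCatSheaf) PUnit ⟶ L, Mono s) :
    cupProduct deg_1_3 (C.ch W L 1) (cupPowTwo Ω 3) = 0 := by
  set t : ℝ := Real.sqrt 2 with ht
  have htpos : 0 < t := Real.sqrt_pos.2 two_pos
  have hP : cupPowTwo Ω 4 ≠ 0 := hΩ.cupPowTwo_ne_zero hW (p := 4) (by norm_num) le_rfl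
  -- the two tests, `q = 1`
  obtain ⟨d₁, -, h₁⟩ := hC W Ω (cupPowTwo Ω 4) hW hΩ ⟨1, one_pos, by rw [Rat.cast_one, one_smul]⟩
    L hL hs
  have hΩ' : IsKaehlerClass 4 W ((t : ℂ) • Ω) := hΩ.smul_of_pos htpos
  obtain ⟨d₂, -, h₂⟩ := hC W ((t : ℂ) • Ω) (cupPowTwo ((t : ℂ) • Ω) 4) hW hΩ'
    ⟨1, one_pos, by rw [Rat.cast_one, one_smul]⟩ L hL hs
  -- compare the two identities on the line spanned by `Ω⁴`
  rw [cupPowTwo_smul, cupPowTwo_smul, map_smul, h₁, smul_smul, smul_smul] at h₂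
  have hc : ((t : ℂ) ^ 3 * (d₁ : ℂ) - (d₂ : ℂ) * (t : ℂ) ^ 4) • cupPowTwo Ω 4 = 0 := by
    rw [sub_smul, h₂, sub_self]
  have hc' : (t : ℂ) ^ 3 * (d₁ : ℂ) - (d₂ : ℂ) * (t : ℂ) ^ 4 = 0 :=
    (smul_eq_zero.1 hc).resolve_right hP
  have htC : (t : ℂ) ≠ 0 := Complex.ofReal_ne_zero.2 htpos.ne'
  have hlin : (d₁ : ℂ) = (d₂ : ℂ) * (t : ℂ) := by
    have h3 : (t : ℂ) ^ 3 ≠ 0 := pow_ne_zero 3 htC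
    have h4 : (t : ℂ) ^ 3 * ((d₁ : ℂ) - (d₂ : ℂ) * (t : ℂ)) = 0 := by
      rw [← hc']; ring
    exact sub_eq_zero.1 ((mul_eq_zero.1 h4).resolve_left h3)
  have hreal : (d₁ : ℝ) = (d₂ : ℝ) * t := by exact_mod_cast hlin
  -- irrationality of `√2`
  have hd₁ : d₁ = 0 := by
    by_cases hd₂ : d₂ = 0
    · subst hd₂
      have h0 : (d₁ : ℝ) = 0 := by rw [hreal, Rat.cast_zero, zero_mul]
      exact_mod_cast h0
    · exfalso
      have hd₂R : (d₂ : ℝ) ≠ 0 := by exact_mod_cast hd₂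
      have hq : t = ((d₁ / d₂ : ℚ) : ℝ) := by
        push_cast
        rw [hreal, mul_div_cancel_left₀ _ hd₂R]
      exact irrational_sqrt_two.ne_rat (d₁ / d₂) (by rw [← ht]; exact hq)
  rw [h₁, hd₁, Rat.cast_zero, zero_smul]

/-- **Under `SignNormalised C` no effective line bundle on a smooth projective fourfold has a Kähler first
Chern character** (`Ω = ch₁(L)` in the degeneracy theorem gives `ch₁(L)⁴ = ch₁(L) ∪ ch₁(L)³ = 0`,
against `[ω]⁴ ≠ 0` for a Kähler class).  For the Chern character, `ch₁(𝒪_{ℙ⁴}(1)) = [ω_FS]` IS Kähler.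
[cite: VoisinHodgeI2002, §3.1.3 Cor. 3.9 and Thm. 7.10] -/
theorem not_isKaehlerClass_ch_one_of_signNormalised {W : Motives.SchemeOver ℂ}
    (hW : Motives.IsSmoothProjective 4 W) (L : W.left.Modules) (hL : Motives.HasRankLE L 1)
    (hs : ∃ s : SheafOfModules.free (R := W.left.ringCatSheaf) PUnit ⟶ L, Mono s) :
    ¬ IsKaehlerClass 4 W (C.ch W L 1) := by
  intro hK
  have h0 := cupProduct_ch_one_cupPowTwo_eq_zero_of_signNormalised C hC hW hK L hL hs
  have h : cupPowTwo (C.ch W L 1) 4 =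
      cupProduct deg_1_3 (cupPowTwo (C.ch W L 1) 1) (cupPowTwo (C.ch W L 1) 3) :=
    cupPowTwo_add (C.ch W L 1) 1 3
  rw [cupPowTwo_one] at h
  exact hK.cupPowTwo_ne_zero hW (p := 4) (by norm_num) le_rfl (h.trans h0)

end SignNormalised

/-! ## Usable contrapositives and the vacuity shape -/

/-- **One effective line bundle with Kähler first Chern character on one smooth projective fourfold
refutes `SignNormalised C`** — so the hypothesis excludes the Chern character itself (`𝒪_{ℙ⁴}(1)`), not
only its sign flip. [cite: VoisinHodgeI2002, Thm. 7.10] -/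
theorem not_signNormalised_of_isKaehlerClass_ch_one (C : ChernCharacterBetti)
    {W : Motives.SchemeOver ℂ} (hW : Motives.IsSmoothProjective 4 W) (L : W.left.Modules)
    (hL : Motives.HasRankLE L 1)
    (hs : ∃ s : SheafOfModules.free (R := W.left.ringCatSheaf) PUnit ⟶ L, Mono s)
    (hK : IsKaehlerClass 4 W (C.ch W L 1)) :
    ¬ ∀ (W : Motives.SchemeOver ℂ) (Ω : complexBetti W (2 * 1)) (vol : complexBetti W (2 * 4)),
      Motives.IsSmoothProjective 4 W → IsKaehlerClass 4 W Ω →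
        (∃ q : ℚ, 0 < q ∧ cupPowTwo Ω 4 = (q : ℂ) • vol) →
          ∀ (L : W.left.Modules), Motives.HasRankLE L 1 →
            (∃ s : SheafOfModules.free (R := W.left.ringCatSheaf) PUnit ⟶ L, Mono s) →
              ∃ d : ℚ, 0 ≤ d ∧ cupProduct deg_1_3 (C.ch W L 1) (cupPowTwo Ω 3) = (d : ℂ) • vol :=
  fun hC ↦ not_isKaehlerClass_ch_one_of_signNormalised C hC hW L hL hs hK

/-- **One effective line bundle of non-zero degree against one Kähler class on one smooth projective
fourfold refutes `SignNormalised C`.** [cite: VoisinHodgeI2002, §3.1.3 Cor. 3.9] -/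
theorem not_signNormalised_of_degree_ne_zero (C : ChernCharacterBetti)
    {W : Motives.SchemeOver ℂ} (hW : Motives.IsSmoothProjective 4 W) {Ω : complexBetti W (2 * 1)}
    (hΩ : IsKaehlerClass 4 W Ω) (L : W.left.Modules) (hL : Motives.HasRankLE L 1)
    (hs : ∃ s : SheafOfModules.free (R := W.left.ringCatSheaf) PUnit ⟶ L, Mono s)
    (hne : cupProduct deg_1_3 (C.ch W L 1) (cupPowTwo Ω 3) ≠ 0) :
    ¬ ∀ (W : Motives.SchemeOver ℂ) (Ω : complexBetti W (2 * 1)) (vol : complexBetti W (2 * 4)),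
      Motives.IsSmoothProjective 4 W → IsKaehlerClass 4 W Ω →
        (∃ q : ℚ, 0 < q ∧ cupPowTwo Ω 4 = (q : ℂ) • vol) →
          ∀ (L : W.left.Modules), Motives.HasRankLE L 1 →
            (∃ s : SheafOfModules.free (R := W.left.ringCatSheaf) PUnit ⟶ L, Mono s) →
              ∃ d : ℚ, 0 ≤ d ∧ cupProduct deg_1_3 (C.ch W L 1) (cupPowTwo Ω 3) = (d : ℂ) • vol :=
  fun hC ↦ hne (cupProduct_ch_one_cupPowTwo_eq_zero_of_signNormalised C hC hW hΩ L hL hs)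

/-- **Vacuity shape.**  Every statement `∀ C, Q C → S C → P C` — the typed crux `NikulinSerreCarrierAlg`
and the stub `stub_stableCarrierNSBlock` have this shape with `S = SignNormalised` — holds outright once
`S` is unsatisfiable. [folklore] -/
theorem forall_of_not_signNormalised {S P Q : ChernCharacterBetti → Prop} (h : ∀ C, ¬ S C) :
    ∀ C, Q C → S C → P C :=
  fun C _ hC ↦ absurd hC (h C)

end Summit.HodgeConjecture.HodgeConjecture.Theorems.NikulinSerreCarrier.Negative.SignNormalisedDegenerate

end
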